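import Mathlib
import HarnessLib
import Literature.MathematicalPhysics.StatisticalMechanics.NextHamiltonianBounds
import Literature.MathematicalPhysics.StatisticalMechanics.StepOperatorBABKMQ

/-!
# The extracted Hamiltonian `H̃ = A^{(q)}_kH + B^{(q)}_kK` at the scale-`k` coefficient norm for step data
# with a kernel BY PREDICATE: size and Lipschitz bounds ([ABKM19] Lemmas 10.5–10.6, `q ∈ B_κ`)

`NextHamiltonianBounds` bounds `‖H̃‖_{k,0}` and `‖H̃ − H̃'‖_{k,0}` for the step data with kernel EQUAL
to the weight kernel `𝒞_{k+1}` (`q = 0`).  Of the kernel its proofs use only `circulant ⪰ 0`, the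
integration property, smoothness/integrability along the section, and the shift bound
`L^{dk}|γ_q| ≤ h²` — i.e. the predicate `StepKernelBounds W L k A𝒫' C₂ D.𝒞` with `C₂ ≤ h²`
(`StepKernelBoundsABKM`).  This file is the `q`-twin (constant `A_𝒫 ↦ A𝒫'`, hypothesis
`hCα`/`secondDiffConst Cα ≤ h²` replaced by `C₂ ≤ h²`):

* `opB_sub_abkm_of_stepKernelBounds` — `B_kK − B_kK' = B_k(K − K')`;
* `hamNorm_opB_abkm_le_scale_of_stepKernelBounds` — Lemma 10.6 at the scale-`k` weights;
* **`hamNorm_nextH_abkm_le_of_stepKernelBounds`** — `‖H̃‖_{k,0} ≤ 2‖H‖ + L^dC_{8.7}A𝒫'A⁻¹‖K‖`;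
* **`hamNorm_nextH_sub_abkm_le_of_stepKernelBounds`** — the Lipschitz form.

The `q = 0` statements are recovered with `AbkmWeightBounds.stepKernelBounds`.  Everything is proved;
no named fact.

## References
* S. Adams, S. Buchholz, R. Kotecký, S. Müller, arXiv:1910.13564, Lemmas 10.5, 10.6, Theorem 6.8,
  Lemma 7.7 [AdamsBuchholzKoteckyMuller2019].
-/

noncomputable section

namespace Literature.MathematicalPhysics.StatisticalMechanics.GradientRG

open scoped BigOperators Classical
open Finset Matrix MeasureTheory
open Literature.MathematicalPhysics.StatisticalMechanics.TorusPolymer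
  (IsPolymer numBlocks blockOf thicken boxCorner isPolymer_blockOf card_blockOf)
open Literature.Barriers.CriticalPhenomena.LongRangePhi4.Polymer (IsConn)
open Literature.MathematicalPhysics.StatisticalMechanics.GradientFRD (iterDiff)
open Literature.MathematicalPhysics.QuantumFieldTheory

variable {d M : ℕ} [NeZero M]

/-- **`B_kK − B_kK' = B_k(K − K')`** for the torus data, for activities with finite weak norm
(`‖K‖_k^{(A)} ≤ C`, `‖K'‖_k^{(A)} ≤ C'`, `C^{r₀}` with `r₀ ≥ 2`, local on connected polymers):
integrability of `K(B₀, φ + ·)` from the norm bound, differentiability of `R_{k+1}K(B₀)` from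
`FluctuationSmooth`. [cite: AdamsBuchholzKoteckyMuller2019, Theorem 6.8 (the operator B_k is linear)] -/
theorem opB_sub_abkm_of_stepKernelBounds {L N Mord R n p r₀ : ℕ} {θbar lam μ δ₁ δ₀ A𝒫 A𝒫' C₂ h A : ℝ}
    {𝒞 : ℕ → (Fin d → ZMod M) → ℝ}
    (hB : AbkmWeightBounds L N Mord R n θbar lam μ δ₁ δ₀ A𝒫 𝒞
      (abkmWeightData L N Mord R θbar (schedDelta δ₀ δ₁ N) 𝒞))
    {k : ℕ} (hr₀ : 2 ≤ r₀) (hLodd : Odd L) (hM : M = L ^ N) (hA : 0 < A)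
    (D : StepData d M) (hS : StepKernelBounds (abkmWeightData L N Mord R θbar (schedDelta δ₀ δ₁ N) 𝒞) L k A𝒫' C₂ D.𝒞) {x₀ : Fin d → ZMod M} (hB₀ : D.B₀ = blockOf (L ^ k) x₀)
    {K K' : Finset (Fin d → ZMod M) → ((Fin d → ZMod M) → ℝ) → ℂ} {C C' : ℝ} (hC : 0 ≤ C) (hC' : 0 ≤ C')
    (hK : WeakNormLE (abkmNormParams L N Mord R p r₀ h θbar A (schedDelta δ₀ δ₁ N) 𝒞) k K C)
    (hK' : WeakNormLE (abkmNormParams L N Mord R p r₀ h θbar A (schedDelta δ₀ δ₁ N) 𝒞) k K' C')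
    (hKd : ∀ X, ContDiff ℝ r₀ (K X)) (hK'd : ∀ X, ContDiff ℝ r₀ (K' X))
    (hKloc : ∀ X, IsPolymer (L ^ k) X → IsConn X →
      IsGaugeLocal ((abkmNormParams L N Mord R p r₀ h θbar A (schedDelta δ₀ δ₁ N) 𝒞).gauge k X) (K X))
    (hK'loc : ∀ X, IsPolymer (L ^ k) X → IsConn X →
      IsGaugeLocal ((abkmNormParams L N Mord R p r₀ h θbar A (schedDelta δ₀ δ₁ N) 𝒞).gauge k X) (K' X)) :
    opB D K - opB D K' = opB D (K - K') := by
  set P := abkmNormParams L N Mord R p r₀ h θbar A (schedDelta δ₀ δ₁ N) 𝒞 with hP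
  have hMo : Odd M := by rw [hM]; exact hLodd.pow
  have hPB : IsPolymer (L ^ k) D.B₀ := by rw [hB₀]; exact isPolymer_blockOf _ x₀
  have hcB : IsConn D.B₀ := by rw [hB₀]; exact TorusPolymer.isConn_blockOf hMo hLodd.pow x₀
  have hCn : 0 ≤ C * P.aFactor k D.B₀ := mul_nonneg hC (WeakNormLE.aFactor_pos hA k _).le
  have hC'n : 0 ≤ C' * P.aFactor k D.B₀ := mul_nonneg hC' (WeakNormLE.aFactor_pos hA k _).le
  have hdom := hS.weightSectionDominated hB.dominated D.B₀ (P.gauge k D.B₀)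
  have hiK : ∀ φ, Integrable (fun ξ => K D.B₀ (φ + ξ)) (stepMeasure D.𝒞) := fun φ => by
    exact integrable_comp_add_of_tayNormLE (hK D.B₀ hPB hcB) hCn (hKd _) (hKloc _ hPB hcB) hdom φ
  have hiK' : ∀ φ, Integrable (fun ξ => K' D.B₀ (φ + ξ)) (stepMeasure D.𝒞) := fun φ => by
    exact integrable_comp_add_of_tayNormLE (hK' D.B₀ hPB hcB) hC'n (hK'd _) (hK'loc _ hPB hcB) hdom φ
  have hdK : ContDiff ℝ 2 (fluct D.𝒞 (K D.B₀)) := by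
    exact (hS.contDiff_fluct hB.dominated D.B₀ (P.gauge k D.B₀) hCn (hKd _) (hKloc _ hPB hcB)
      (hK D.B₀ hPB hcB)).of_le (by exact_mod_cast hr₀)
  have hdK' : ContDiff ℝ 2 (fluct D.𝒞 (K' D.B₀)) := by
    exact (hS.contDiff_fluct hB.dominated D.B₀ (P.gauge k D.B₀) hC'n (hK'd _) (hK'loc _ hPB hcB)
      (hK' D.B₀ hPB hcB)).of_le (by exact_mod_cast hr₀)
  unfold opB
  rw [Pi.sub_apply, fluct_sub_of_integrable hiK hiK', Pi2_sub_of_contDiff _ _ hdK hdK', neg_sub_neg, neg_sub]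

/-- **[ABKM19] Lemma 10.6 for the torus data at the scale-`k` coefficient norm**: for `L` odd,
`L ≥ 2^{d+3} + 16R`, `M = L^N`, `k + 1 ≤ N`, `p ≤ R`, `r₀ ≥ 2`, `h > 0`, `θ̄, λ > 0`, a weight tower with the
conclusions of Theorem 7.1 (integration constant `A_𝒫`), `A ≥ 1`, step data of scale `k` (kernel
`𝒞_{k+1}`, reference block `B_{x₀}`, base point the corner of `B_{x₀}*`), and a local `C^{r₀}` activity with
`‖K‖_k^{(A)} ≤ C`: `‖B_k K‖_{k,0} ≤ C_{8.7} · C A_𝒫 A^{−1}` in `hamNorm 𝔥_k L^k L^{dk}`.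
[cite: AdamsBuchholzKoteckyMuller2019, Lemma 10.6 (10.42)–(10.43)] -/
theorem hamNorm_opB_abkm_le_scale_of_stepKernelBounds {L N Mord R n p r₀ : ℕ} {θbar lam μ δ₁ δ₀ A𝒫 A𝒫' C₂ h A : ℝ}
    {𝒞 : ℕ → (Fin d → ZMod M) → ℝ} (hLodd : Odd L) (hL : 2 ^ (d + 3) + 16 * R ≤ L)
    (hM : M = L ^ N) {k : ℕ} (hkN : k + 1 ≤ N) (hpR : p ≤ R)
    (hr₀ : 2 ≤ r₀)
    (hB : AbkmWeightBounds L N Mord R n θbar lam μ δ₁ δ₀ A𝒫 𝒞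
      (abkmWeightData L N Mord R θbar (schedDelta δ₀ δ₁ N) 𝒞))
    (hh : 0 < h) (hA : 1 ≤ A)
    (D : StepData d M) (hS : StepKernelBounds (abkmWeightData L N Mord R θbar (schedDelta δ₀ δ₁ N) 𝒞) L k A𝒫' C₂ D.𝒞) {x₀ : Fin d → ZMod M} (hB₀ : D.B₀ = blockOf (L ^ k) x₀)
    (hc₀ : D.c₀ = boxCorner (L ^ k) (starRad R L d k) x₀)
    {K : Finset (Fin d → ZMod M) → ((Fin d → ZMod M) → ℝ) → ℂ} {C : ℝ} (hC : 0 ≤ C)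
    (hK : WeakNormLE (abkmNormParams L N Mord R p r₀ h θbar A (schedDelta δ₀ δ₁ N) 𝒞) k K C)
    (hKd : ∀ X, ContDiff ℝ r₀ (K X))
    (hKloc : ∀ X, IsPolymer (L ^ k) X → IsConn X →
      IsGaugeLocal ((abkmNormParams L N Mord R p r₀ h θbar A (schedDelta δ₀ δ₁ N) 𝒞).gauge k X) (K X)) :
    hamNorm (fieldWt h L d k) ((L : ℝ) ^ k) (L ^ (d * k)) (opB D K) ≤
      pi2BoundConst d (((2 * R + 2 : ℕ) : ℝ) + ((d / 2 + 1 : ℕ) : ℝ)) * (C * A𝒫' * A⁻¹) := by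
  set P := abkmNormParams L N Mord R p r₀ h θbar A (schedDelta δ₀ δ₁ N) 𝒞 with hP
  have hL0 : (0 : ℝ) < L := by exact_mod_cast hLodd.pos
  -- the torus at scale `k`
  obtain ⟨t, ht⟩ : ∃ t, N = k + t := ⟨N - k, by omega⟩
  have hMt0 : M = L ^ k * L ^ t := by rw [← pow_add, ← ht]; exact hM
  have hMt : M = P.L ^ k * L ^ t := hMt0
  have htodd : Odd (L ^ t) := hLodd.pow
  have h𝔥k : 0 < P.𝔥 k := fieldWt_pos hh hL0 d k
  have hR : 0 < P.R k := by show (0 : ℝ) < (L : ℝ) ^ k; positivity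
  have hr₀' : 2 ≤ P.r₀ := hr₀
  -- the box
  obtain ⟨hwrap0, hroom0⟩ := abkm_box_lt (d := d) hL hpR hkN
  have hwrap : 4 * ((P.L ^ k - 1) / 2 + P.rad k) < M := by
    show 4 * ((L ^ k - 1) / 2 + starRad R L d k) < M; rw [hM]; exact hwrap0
  have hroom : ((2 * ((P.L ^ k - 1) / 2 + P.rad k) : ℕ) + (P.p : ℤ)) * 2 < M := by
    show ((2 * ((L ^ k - 1) / 2 + starRad R L d k) : ℕ) + (p : ℤ)) * 2 < (M : ℤ)
    rw [hM]; exact_mod_cast hroom0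
  have hC₀ : (1 : ℝ) ≤ ((2 * R + 2 : ℕ) : ℝ) + ((d / 2 + 1 : ℕ) : ℝ) := by
    have : (1 : ℝ) ≤ ((2 * R + 2 : ℕ) : ℝ) := by exact_mod_cast (show 1 ≤ 2 * R + 2 by omega)
    linarith [(Nat.cast_nonneg (d / 2 + 1) : (0 : ℝ) ≤ _)]
  have hρ0 : ((2 * ((P.L ^ k - 1) / 2 + P.rad k) : ℕ) : ℝ) + (d / 2 + 1 : ℕ) ≤
      (((2 * R + 2 : ℕ) : ℝ) + ((d / 2 + 1 : ℕ) : ℝ)) * P.R k := abkm_box_C0 (d := d) hL k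
  -- integration property
  have hk1 : k + 1 ≤ N + 1 := by omega
  have hint : IntegrationProperty P k D.𝒞 A𝒫' := by
    exact integrationProperty_of_stepKernelBounds hB hS p r₀ h A
  -- `B_k K` only sees `K(B₀)`; replace `K` by its restriction to connected `k`-polymers
  set K' : Finset (Fin d → ZMod M) → ((Fin d → ZMod M) → ℝ) → ℂ :=
    fun X => if IsPolymer (L ^ k) X ∧ IsConn X then K X else 0 with hK'def
  have hMo : Odd M := by rw [hM]; exact hLodd.pow
  have hPB : IsPolymer (L ^ k) D.B₀ := by rw [hB₀]; exact isPolymer_blockOf _ x₀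
  have hcB : IsConn D.B₀ := by rw [hB₀]; exact TorusPolymer.isConn_blockOf hMo hLodd.pow x₀
  have hK'B : K' D.B₀ = K D.B₀ := by simp only [hK'def, hPB, hcB, and_self, if_true]
  have hopB : opB D K = opB D K' := by unfold opB; rw [hK'B]
  have hK' : WeakNormLE P k K' C := fun X hX hc => by
    have : K' X = K X := by
      show (if IsPolymer (L ^ k) X ∧ IsConn X then K X else 0) = K X
      exact if_pos ⟨hX, hc⟩
    rw [this]; exact hK X hX hc
  have hK'd : ∀ X, ContDiff ℝ P.r₀ (K' X) := fun X => by
    by_cases hX : IsPolymer (L ^ k) X ∧ IsConn X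
    · simp only [hK'def, if_pos hX]; exact hKd X
    · simp only [hK'def, if_neg hX]; exact contDiff_const
  have hK'loc : ∀ X, IsPolymer (P.L ^ k) X → IsConn X → IsGaugeLocal (P.gauge k X) (K' X) :=
    fun X hX hc => by
      have : K' X = K X := by
        show (if IsPolymer (L ^ k) X ∧ IsConn X then K X else 0) = K X
        exact if_pos ⟨hX, hc⟩
      rw [this]; exact hKloc X hX hc
  have hA0 : 0 < A := by linarith
  have hR'd : ∀ X, ContDiff ℝ P.r₀ (fluct D.𝒞 (K' X)) := fun X => by
    by_cases hX : IsPolymer (L ^ k) X ∧ IsConn X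
    · exact contDiff_fluct_of_weakNormLE_of_stepKernelBounds hB hS hA0 hC hK' hK'd hK'loc hX.1 hX.2
    · have : K' X = 0 := by simp only [hK'def, if_neg hX]
      rw [this]
      have h0 : fluct D.𝒞 (0 : ((Fin d → ZMod M) → ℝ) → ℂ) = fun _ => 0 := by
        funext φ; unfold fluct; simp
      rw [h0]; exact contDiff_const
  -- Lemma 10.6 (abstract, scale-`k` weights) for `K'`
  have hmain := hamNorm_opB_le P hMt hLodd htodd D hB₀ hc₀ h𝔥k hR hr₀' hwrap hroom hC₀ hρ0 hint hC hK' hK'd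
    hK'loc hR'd hA
  have hcard : D.B₀.card = L ^ (d * k) := by
    rw [hB₀, card_blockOf hMt0 hLodd.pow htodd x₀, ← pow_mul, mul_comm]
  rw [hopB, ← hcard]
  exact hmain

/-- **`‖H̃‖_{k,0} ≤ 2‖H‖_{k,0} + C_{8.7} A_𝒫 A^{−1} C`** for `H̃ = nextH D H K = A_kH + B_kK` (torus data,
`d ≥ 2`, `h² ≥ C_{2,0}` for the kernel regularity constant, hypotheses of `hamNorm_opB_abkm_le_scale_of_stepKernelBounds`).
[cite: AdamsBuchholzKoteckyMuller2019, Theorem 6.8 (6.55)–(6.57) / Lemma 10.6] -/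
theorem hamNorm_nextH_abkm_le_of_stepKernelBounds {L N Mord R n p r₀ : ℕ} {θbar lam μ δ₁ δ₀ A𝒫 A𝒫' C₂ h A : ℝ}
    {𝒞 : ℕ → (Fin d → ZMod M) → ℝ} (hd : 2 ≤ d) (hLodd : Odd L) (hL : 2 ^ (d + 3) + 16 * R ≤ L)
    (hM : M = L ^ N) {k : ℕ} (hkN : k + 1 ≤ N) (hp : d / 2 + 1 ≤ p) (hpR : p ≤ R)
    (hr₀ : 2 ≤ r₀)
    (hB : AbkmWeightBounds L N Mord R n θbar lam μ δ₁ δ₀ A𝒫 𝒞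
      (abkmWeightData L N Mord R θbar (schedDelta δ₀ δ₁ N) 𝒞))
    (hh : 0 < h)
    (hh2 : C₂ ≤ h ^ 2) (hA : 1 ≤ A)
    (D : StepData d M) (hS : StepKernelBounds (abkmWeightData L N Mord R θbar (schedDelta δ₀ δ₁ N) 𝒞) L k A𝒫' C₂ D.𝒞) {x₀ : Fin d → ZMod M} (hB₀ : D.B₀ = blockOf (L ^ k) x₀)
    (hc₀ : D.c₀ = boxCorner (L ^ k) (starRad R L d k) x₀)
    (H : RelevantHamiltonian ℂ d)
    {K : Finset (Fin d → ZMod M) → ((Fin d → ZMod M) → ℝ) → ℂ} {C : ℝ} (hC : 0 ≤ C)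
    (hK : WeakNormLE (abkmNormParams L N Mord R p r₀ h θbar A (schedDelta δ₀ δ₁ N) 𝒞) k K C)
    (hKd : ∀ X, ContDiff ℝ r₀ (K X))
    (hKloc : ∀ X, IsPolymer (L ^ k) X → IsConn X →
      IsGaugeLocal ((abkmNormParams L N Mord R p r₀ h θbar A (schedDelta δ₀ δ₁ N) 𝒞).gauge k X) (K X)) :
    hamNorm (fieldWt h L d k) ((L : ℝ) ^ k) (L ^ (d * k)) (nextH D H K) ≤
      2 * hamNorm (fieldWt h L d k) ((L : ℝ) ^ k) (L ^ (d * k)) H +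
        pi2BoundConst d (((2 * R + 2 : ℕ) : ℝ) + ((d / 2 + 1 : ℕ) : ℝ)) * (C * A𝒫' * A⁻¹) := by
  have hL0 : (0 : ℝ) < L := by exact_mod_cast hLodd.pos
  have hL1 : 1 ≤ L := hLodd.pos
  have hk1 : k + 1 ≤ N + 1 := by omega
  obtain ⟨t, ht⟩ : ∃ t, N = k + t := ⟨N - k, by omega⟩
  have hMt0 : M = L ^ k * L ^ t := by rw [← pow_add, ← ht]; exact hM
  have htodd : Odd (L ^ t) := hLodd.pow
  -- the hypotheses of `nextH_eq`
  have hC𝒞 : (Matrix.circulant D.𝒞).PosSemidef := hS.posSemidef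
  have hBne : D.B₀.card ≠ 0 := by
    rw [hB₀]; exact (card_pos.2 ⟨x₀, TorusPolymer.mem_blockOf_self _ x₀⟩).ne'
  obtain ⟨hwrap0, hroom0⟩ := abkm_box_lt (d := d) hL hpR hkN
  have hwrap : 4 * ((L ^ k - 1) / 2 + starRad R L d k) < M := by rw [hM]; exact hwrap0
  have hroomB : ∀ x ∈ D.B₀, HasRoom D.c₀ x (d / 2 + 1) := by
    intro x hx
    have hxS : x ∈ thicken (starRad R L d k) (blockOf (L ^ k) x₀) := by
      rw [← hB₀]; exact TorusPolymer.subset_thicken _ _ hx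
    have hin := (TorusPolymer.mem_thicken_blockOf_iff_inBox hMt0 hLodd.pow htodd hwrap x₀ x).1 hxS
    rw [hc₀]
    refine TorusPolymer.hasRoom_of_inBox hin ?_
    have h2 : ((2 * ((L ^ k - 1) / 2 + starRad R L d k) : ℕ) + ((d / 2 + 1 : ℕ) : ℤ)) * 2 < (M : ℤ) := by
      have : (2 * ((L ^ k - 1) / 2 + starRad R L d k) + (d / 2 + 1)) * 2 < M := by
        rw [hM]; have := hroom0; omega
      exact_mod_cast this
    exact_mod_cast h2
  rw [nextH_eq D hC𝒞 hBne hroomB H K]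
  -- `‖A_kH‖ ≤ 2‖H‖`
  have hγ : ∀ q, ((L ^ (d * k) : ℕ) : ℝ) * |gradCov D.𝒞 q| ≤ h ^ 2 := fun q => by
    exact abs_gradCov_le_of_stepKernelBounds hS hh2 q
  have hAH := hamNorm_stepOpA_abkm_le (𝕜 := ℂ) hd hL1 hh k hγ H
  -- `‖B_kK‖`
  have hBK := hamNorm_opB_abkm_le_scale_of_stepKernelBounds hLodd hL hM hkN hpR hr₀ hB hh hA D hS hB₀ hc₀ hC hK hKd hKloc
  refine (hamNorm_add_le (fieldWt_pos hh hL0 d k).le (by positivity) _ _ _).trans ?_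
  have hcast : hamNorm (fieldWt h (L : ℝ) d k) ((L : ℝ) ^ k) (L ^ (d * k)) (stepOpA (gradCov D.𝒞) H) ≤
      2 * hamNorm (fieldWt h (L : ℝ) d k) ((L : ℝ) ^ k) (L ^ (d * k)) H := hAH
  exact add_le_add hcast hBK

/-- **`‖H̃ − H̃'‖_{k,0} ≤ 2‖H − H'‖_{k,0} + C_{8.7} A_𝒫 A^{−1} C_Δ`** for `H̃ = nextH D H K`,
`H̃' = nextH D H' K'` with `‖K‖_k^{(A)} ≤ C`, `‖K'‖_k^{(A)} ≤ C'`, `‖K − K'‖_k^{(A)} ≤ C_Δ` (torus data;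
`H ↦ A_kH` and `K ↦ B_kK` are additive). [cite: AdamsBuchholzKoteckyMuller2019, Theorem 6.8 (6.55)–(6.57)] -/
theorem hamNorm_nextH_sub_abkm_le_of_stepKernelBounds {L N Mord R n p r₀ : ℕ} {θbar lam μ δ₁ δ₀ A𝒫 A𝒫' C₂ h A : ℝ}
    {𝒞 : ℕ → (Fin d → ZMod M) → ℝ} (hd : 2 ≤ d) (hLodd : Odd L) (hL : 2 ^ (d + 3) + 16 * R ≤ L)
    (hM : M = L ^ N) {k : ℕ} (hkN : k + 1 ≤ N) (hp : d / 2 + 1 ≤ p) (hpR : p ≤ R)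
    (hr₀ : 2 ≤ r₀)
    (hB : AbkmWeightBounds L N Mord R n θbar lam μ δ₁ δ₀ A𝒫 𝒞
      (abkmWeightData L N Mord R θbar (schedDelta δ₀ δ₁ N) 𝒞))
    (hh : 0 < h)
    (hh2 : C₂ ≤ h ^ 2) (hA : 1 ≤ A)
    (D : StepData d M) (hS : StepKernelBounds (abkmWeightData L N Mord R θbar (schedDelta δ₀ δ₁ N) 𝒞) L k A𝒫' C₂ D.𝒞) {x₀ : Fin d → ZMod M} (hB₀ : D.B₀ = blockOf (L ^ k) x₀)
    (hc₀ : D.c₀ = boxCorner (L ^ k) (starRad R L d k) x₀)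
    (H H' : RelevantHamiltonian ℂ d)
    {K K' : Finset (Fin d → ZMod M) → ((Fin d → ZMod M) → ℝ) → ℂ} {C C' CΔ : ℝ} (hC : 0 ≤ C)
    (hC' : 0 ≤ C') (hCΔ : 0 ≤ CΔ)
    (hK : WeakNormLE (abkmNormParams L N Mord R p r₀ h θbar A (schedDelta δ₀ δ₁ N) 𝒞) k K C)
    (hK' : WeakNormLE (abkmNormParams L N Mord R p r₀ h θbar A (schedDelta δ₀ δ₁ N) 𝒞) k K' C')
    (hΔ : WeakNormLE (abkmNormParams L N Mord R p r₀ h θbar A (schedDelta δ₀ δ₁ N) 𝒞) k (K - K') CΔ)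
    (hKd : ∀ X, ContDiff ℝ r₀ (K X)) (hK'd : ∀ X, ContDiff ℝ r₀ (K' X))
    (hKloc : ∀ X, IsPolymer (L ^ k) X → IsConn X →
      IsGaugeLocal ((abkmNormParams L N Mord R p r₀ h θbar A (schedDelta δ₀ δ₁ N) 𝒞).gauge k X) (K X))
    (hK'loc : ∀ X, IsPolymer (L ^ k) X → IsConn X →
      IsGaugeLocal ((abkmNormParams L N Mord R p r₀ h θbar A (schedDelta δ₀ δ₁ N) 𝒞).gauge k X) (K' X)) :
    hamNorm (fieldWt h L d k) ((L : ℝ) ^ k) (L ^ (d * k)) (nextH D H K - nextH D H' K') ≤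
      2 * hamNorm (fieldWt h L d k) ((L : ℝ) ^ k) (L ^ (d * k)) (H - H') +
        pi2BoundConst d (((2 * R + 2 : ℕ) : ℝ) + ((d / 2 + 1 : ℕ) : ℝ)) * (CΔ * A𝒫' * A⁻¹) := by
  have hL0 : (0 : ℝ) < L := by exact_mod_cast hLodd.pos
  have hL1 : 1 ≤ L := hLodd.pos
  have hA0 : 0 < A := by linarith
  have hk1 : k + 1 ≤ N + 1 := by omega
  obtain ⟨t, ht⟩ : ∃ t, N = k + t := ⟨N - k, by omega⟩
  have hMt0 : M = L ^ k * L ^ t := by rw [← pow_add, ← ht]; exact hM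
  have htodd : Odd (L ^ t) := hLodd.pow
  -- the hypotheses of `nextH_eq`
  have hC𝒞 : (Matrix.circulant D.𝒞).PosSemidef := hS.posSemidef
  have hBne : D.B₀.card ≠ 0 := by
    rw [hB₀]; exact (card_pos.2 ⟨x₀, TorusPolymer.mem_blockOf_self _ x₀⟩).ne'
  obtain ⟨hwrap0, hroom0⟩ := abkm_box_lt (d := d) hL hpR hkN
  have hwrap : 4 * ((L ^ k - 1) / 2 + starRad R L d k) < M := by rw [hM]; exact hwrap0
  have hroomB : ∀ x ∈ D.B₀, HasRoom D.c₀ x (d / 2 + 1) := by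
    intro x hx
    have hxS : x ∈ thicken (starRad R L d k) (blockOf (L ^ k) x₀) := by
      rw [← hB₀]; exact TorusPolymer.subset_thicken _ _ hx
    have hin := (TorusPolymer.mem_thicken_blockOf_iff_inBox hMt0 hLodd.pow htodd hwrap x₀ x).1 hxS
    rw [hc₀]
    refine TorusPolymer.hasRoom_of_inBox hin ?_
    have h2 : ((2 * ((L ^ k - 1) / 2 + starRad R L d k) : ℕ) + ((d / 2 + 1 : ℕ) : ℤ)) * 2 < (M : ℤ) := by
      have : (2 * ((L ^ k - 1) / 2 + starRad R L d k) + (d / 2 + 1)) * 2 < M := by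
        rw [hM]; have := hroom0; omega
      exact_mod_cast this
    exact_mod_cast h2
  -- the two differences
  have hKΔd : ∀ X, ContDiff ℝ r₀ ((K - K') X) := fun X => by
    show ContDiff ℝ r₀ (K X - K' X); exact (hKd X).sub (hK'd X)
  have hKΔloc : ∀ X, IsPolymer (L ^ k) X → IsConn X →
      IsGaugeLocal ((abkmNormParams L N Mord R p r₀ h θbar A (schedDelta δ₀ δ₁ N) 𝒞).gauge k X) ((K - K') X) :=
    fun X hX hc φ ψ e => by
      show (K X - K' X) φ = (K X - K' X) ψ
      simp only [Pi.sub_apply]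
      rw [hKloc X hX hc φ ψ e, hK'loc X hX hc φ ψ e]
  have hsub : nextH D H K - nextH D H' K' = stepOpA (gradCov D.𝒞) (H - H') + opB D (K - K') := by
    rw [nextH_eq D hC𝒞 hBne hroomB H K, nextH_eq D hC𝒞 hBne hroomB H' K', stepOpA_sub,
      ← opB_sub_abkm_of_stepKernelBounds hB hr₀ hLodd hM hA0 D hS hB₀ hC hC' hK hK' hKd hK'd hKloc hK'loc]
    abel
  rw [hsub]
  have hγ : ∀ q, ((L ^ (d * k) : ℕ) : ℝ) * |gradCov D.𝒞 q| ≤ h ^ 2 := fun q => by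
    exact abs_gradCov_le_of_stepKernelBounds hS hh2 q
  have hAH := hamNorm_stepOpA_abkm_le (𝕜 := ℂ) hd hL1 hh k hγ (H - H')
  have hBK := hamNorm_opB_abkm_le_scale_of_stepKernelBounds hLodd hL hM hkN hpR hr₀ hB hh hA D hS hB₀ hc₀ hCΔ hΔ hKΔd
    hKΔloc
  refine (hamNorm_add_le (fieldWt_pos hh hL0 d k).le (by positivity) _ _ _).trans ?_
  have hcast : hamNorm (fieldWt h (L : ℝ) d k) ((L : ℝ) ^ k) (L ^ (d * k)) (stepOpA (gradCov D.𝒞) (H - H')) ≤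
      2 * hamNorm (fieldWt h (L : ℝ) d k) ((L : ℝ) ^ k) (L ^ (d * k)) (H - H') := hAH
  exact add_le_add hcast hBK

end Literature.MathematicalPhysics.StatisticalMechanics.GradientRG

end
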